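import Summits.Ventures.PercRepro.Night2LocalDQm1ZeroFat
import Summits.Ventures.PercRepro.Night2LocalKColoops
import Summits.Ventures.PercRepro.Night2SevenFiveReduction

/-!
# PercRepro — the regime `|E ∖ G| = q − 1` reduces to `1 ≤ kColoops ≤ q − 2`; the `(7, 5)` row sharpened (night-2, gen 12)

* **`localShadowHall_dqm1_of_kColoops_mid`**: at `|E ∖ G| = q − 1` (`q ≥ 3`, loopless simple `M`) the local form holds as soon
  as it holds at the flats with `1 ≤ kColoops G ≤ q − 2` — `kColoops = 0` is THEOREM F (`localShadowHall_dqm1_zero`),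
  `kColoops ≥ q − 1` is `localShadowHall_of_card_le_kColoops`;
* **`shadowHall_seven_five_of_local_sharp`**: the `(7, 5)` shadow row for EVERY finite matroid, modulo the local form of
  loopless simple matroids at `q′ = 4`: `|E ∖ G| = 2` with `kColoops ≤ 1`, `|E ∖ G| = 3` with `1 ≤ kColoops ≤ 2`; and at
  `q′ = 5`: `|E ∖ G| = 2` with `kColoops ≤ 1`, `|E ∖ G| = 3` with `kColoops ≤ 2`, `|E ∖ G| = 4` with `1 ≤ kColoops ≤ 3`
  (gen 11's `shadowHall_seven_five_of_local` sharpened by Theorem F and the coloop-count cells; the cell `|E ∖ G| = 3`,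
  `kColoops = 0` at `q′ = 5` is NOT Theorem F's — that needs `|E ∖ G| = q′ − 1`).
-/

open scoped Matroid

namespace PercRepro.Shadow

open Finset PerFlat ThmH

variable {α : Type*} [DecidableEq α] {M : Matroid α} [M.Finite]

section Mid

variable {q : ℕ} {G : Finset α}

/-- **The regime `|E ∖ G| = q − 1` reduces to `1 ≤ kColoops G ≤ q − 2`** (loopless simple `M`, `q ≥ 3`). -/
theorem localShadowHall_dqm1_of_kColoops_mid (hq : 3 ≤ q)
    (hs : ∀ e ∈ gr M, ∀ f ∈ gr M, e ≠ f → rkN M {e, f} = 2) (hl : ∀ e ∈ gr M, M.Indep {e})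
    (hloc : ∀ G ∈ flatsQ M (q + 1), (gr M \ G).card + 1 = q → 1 ≤ kColoops M G → kColoops M G + 2 ≤ q →
      LocalShadowHall M q G)
    (hG : G ∈ flatsQ M (q + 1)) (hd : (gr M \ G).card + 1 = q) : LocalShadowHall M q G := by
  rcases Nat.lt_or_ge (kColoops M G) 1 with h0 | h1
  · exact localShadowHall_dqm1_zero hq hs hl hG hd (by omega)
  · rcases Nat.lt_or_ge (kColoops M G + 1) q with hmid | hbig
    · exact hloc G hG hd h1 (by omega)
    · have hdq : (gr M \ G).card ≤ q := by omega
      have hk : (gr M \ G).card ≤ kColoops M G := by omega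
      exact localShadowHall_of_card_le_kColoops hG rfl hdq hk

end Mid

section SevenFive

variable {α' : Type} [DecidableEq α']

/-- **THE `(7, 5)` SHADOW ROW FOR EVERY FINITE MATROID, MODULO THE SMALL-COLOOP CELLS** of loopless simple matroids:
at `q′ = 4` the flats with `|E ∖ G| = 2`, `kColoops ≤ 1` and `|E ∖ G| = 3`, `1 ≤ kColoops ≤ 2` (encoded as
`kColoops + 1 ≤ |E ∖ G|` and `1 ≤ kColoops + 3 − |E ∖ G|`); at `q′ = 5` the flats with `|E ∖ G| = 2`, `kColoops ≤ 1`,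
`|E ∖ G| = 3`, `kColoops ≤ 2`, and `|E ∖ G| = 4`, `1 ≤ kColoops ≤ 3` (encoded as `kColoops + 1 ≤ |E ∖ G|` and
`1 ≤ kColoops + 4 − |E ∖ G|`). -/
theorem shadowHall_seven_five_of_local_sharp
    (hloc4 : ∀ (N : Matroid α') [N.Finite], (∀ e ∈ gr N, ∀ f ∈ gr N, e ≠ f → rkN N {e, f} = 2) →
      (∀ e ∈ gr N, N.Indep {e}) → N.eRank = ((4 + 2 : ℕ) : ℕ∞) →
      ∀ G ∈ flatsQ N (4 + 1), 2 ≤ (gr N \ G).card → (gr N \ G).card ≤ 3 →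
        kColoops N G + 1 ≤ (gr N \ G).card → 1 ≤ kColoops N G + 3 - (gr N \ G).card → LocalShadowHall N 4 G)
    (hloc5 : ∀ (N : Matroid α') [N.Finite], (∀ e ∈ gr N, ∀ f ∈ gr N, e ≠ f → rkN N {e, f} = 2) →
      (∀ e ∈ gr N, N.Indep {e}) → N.eRank = ((5 + 2 : ℕ) : ℕ∞) →
      ∀ G ∈ flatsQ N (5 + 1), 2 ≤ (gr N \ G).card → (gr N \ G).card ≤ 4 →
        kColoops N G + 1 ≤ (gr N \ G).card → 1 ≤ kColoops N G + 4 - (gr N \ G).card → LocalShadowHall N 5 G)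
    (M : Matroid α') [M.Finite] : ShadowHall M 7 5 (phiK 7 5) := by
  apply shadowHall_seven_five_of_local
  · -- `q′ = 4`
    intro N _ hs hl hN G hG h2 h3
    rcases Nat.lt_or_ge (kColoops N G) (gr N \ G).card with hk | hk
    · by_cases h30 : (gr N \ G).card = 3 ∧ kColoops N G = 0
      · exact localShadowHall_d3_zero hs hl hG h30.1 h30.2
      · have ha : kColoops N G + 1 ≤ (gr N \ G).card := by omega
        have hb : 1 ≤ kColoops N G + 3 - (gr N \ G).card := by
          rcases Nat.lt_or_ge (gr N \ G).card 3 with hd2 | hd3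
          · omega
          · have hd3' : (gr N \ G).card = 3 := by omega
            have : kColoops N G ≠ 0 := fun h0 => h30 ⟨hd3', h0⟩
            omega
        exact hloc4 N hs hl hN G hG h2 h3 ha hb
    · have hdq : (gr N \ G).card ≤ 4 := by omega
      exact localShadowHall_of_card_le_kColoops hG rfl hdq hk
  · -- `q′ = 5`
    intro N _ hs hl hN G hG h2 h4
    rcases Nat.lt_or_ge (kColoops N G) (gr N \ G).card with hk | hk
    · by_cases h40 : (gr N \ G).card = 4 ∧ kColoops N G = 0
      · have hd' : (gr N \ G).card + 1 = 5 := by omega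
        exact localShadowHall_dqm1_zero (by norm_num) hs hl hG hd' h40.2
      · have ha : kColoops N G + 1 ≤ (gr N \ G).card := by omega
        have hb : 1 ≤ kColoops N G + 4 - (gr N \ G).card := by
          rcases Nat.lt_or_ge (gr N \ G).card 4 with hd3 | hd4
          · omega
          · have hd4' : (gr N \ G).card = 4 := by omega
            have : kColoops N G ≠ 0 := fun h0 => h40 ⟨hd4', h0⟩
            omega
        exact hloc5 N hs hl hN G hG h2 h4 ha hb
    · have hdq : (gr N \ G).card ≤ 5 := by omega
      exact localShadowHall_of_card_le_kColoops hG rfl hdq hk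

end SevenFive

end PercRepro.Shadow
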